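import Summits.AtomisticToContinuum.BoseEinsteinCondensation.Theorems.BECInsertionCorrectorCorrectorClosureGroundStateExistsOfFK
import Literature.MathematicalPhysics.QuantumManyBody.PeriodicGroundStateFeynmanKacProofs
import HarnessLib

/-!
# Existence of the torus Feynman–Kac ground states at fixed density
(line `residue-area-law`, stub 1, unconditional)

Crux `BECInsertionCorrector.CorrectorClosure` (item stmt-AtomisticToContinuum-12058), line
`residue-area-law`, stub `stub_groundStateExists` (typed VERBATIM as the stub of the same name of
line `healing-scale-kac-insertion`, so this landing serves both lines).

The conditional form `groundStateExists_of_feynmanKac`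
(`BECInsertionCorrectorCorrectorClosureGroundStateExistsOfFK.lean`) takes the named fact
`PeriodicGroundStateFeynmanKac` as a hypothesis; the fact is discharged in the tree by
`PeriodicGroundStateFeynmanKac_holds` (`PeriodicGroundStateFeynmanKacProofs.lean`), and the stub is
the one-line specialisation.
-/

noncomputable section

open MeasureTheory Filter Matrix
open scoped ENNReal NNReal BigOperators

namespace Summit.AtomisticToContinuum.BoseEinsteinCondensation.Theorems.CorrectorClosure.ResidueAreaLaw

open Literature.MathematicalPhysics.QuantumManyBody.BoseGas

/-- **Stub 1 of line `residue-area-law` — existence of the torus FK ground states at fixed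
density (bounded potentials).** For a BOUNDED repulsive finite-range `v` there is `ρ₀ > 0` such
that for `0 < ρ < ρ₀` and all large `N`, in the box `L = ((N+1)/ρ)^{1/3}`: the periodised
potential is bounded, and the `N`- and `(N+1)`-body torus Hamiltonians have Feynman–Kac ground
states (`IsPeriodicGroundStateFK` for the canonical `periodicFKGroundState`), continuous and
strictly positive. The conditional form `groundStateExists_of_feynmanKac` fed with
`PeriodicGroundStateFeynmanKac_holds`.
[cite: ChungZhao1995, §3.2 (26), Thm 3.10 and Props 3.11–3.15; ReedSimonIV1978, Thm XIII.44] -/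
theorem stub_groundStateExists (v : ℝ → ℝ≥0∞) (hv : IsRepulsiveFiniteRange v)
    (hbdd : ∃ C : ℝ≥0, ∀ r, v r ≤ C) :
    ∃ ρ₀ : ℝ, 0 < ρ₀ ∧ ∀ ρ : ℝ, 0 < ρ → ρ < ρ₀ → ∀ᶠ N : ℕ in atTop,
      (∃ C : ℝ≥0, ∀ x, periodizedPotential v (sideLength ρ (N + 1)) x ≤ C) ∧
      (IsPeriodicGroundStateFK v (sideLength ρ (N + 1)) (periodicFKGroundState v N (sideLength ρ (N + 1))) ∧
        Continuous (periodicFKGroundState v N (sideLength ρ (N + 1))) ∧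
        ∀ X, 0 < periodicFKGroundState v N (sideLength ρ (N + 1)) X) ∧
      (IsPeriodicGroundStateFK v (sideLength ρ (N + 1))
          (periodicFKGroundState v (N + 1) (sideLength ρ (N + 1))) ∧
        Continuous (periodicFKGroundState v (N + 1) (sideLength ρ (N + 1))) ∧
        ∀ X, 0 < periodicFKGroundState v (N + 1) (sideLength ρ (N + 1)) X) :=
  groundStateExists_of_feynmanKac PeriodicGroundStateFeynmanKac_holds v hv hbdd

end Summit.AtomisticToContinuum.BoseEinsteinCondensation.Theorems.CorrectorClosure.ResidueAreaLaw

end
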